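import Mathlib
import Summits.ResolutionOfSingularities.ResolutionOfSingularities.Theorems.HomologicalConductorNoZenoBirthDefs
import Summits.ResolutionOfSingularities.ResolutionOfSingularities.Theorems.SyzygyFlatteningHigherRankTerminationLocAt
import Summits.ResolutionOfSingularities.ResolutionOfSingularities.Theorems.SyzygyFlatteningHigherRankTerminationNrmLocAt
import HarnessLib

/-!
# The K-C3 TOWER STEP, part 1: the abstract sandwich `T_{m+1} = loc O W` over the route vocabulary
# `ca / loc / chart / nrm / tower` (crux `Persistence`, stmt-ResolutionOfSingularities-16484; chain W4.4b K-C3 §H2L, object K3b)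

Route `ResolutionOfSingularities/HomologicalConductor` (cell res-hironaka; seat res-D-pv-043; res-L1-w44b-plan-1 OBJECTS FOR THE IDLE
POOL 2026-08-27T11:15:05Z «K3b THE K-C3 TOWER STEP», res-plan-2 DEAL #7v; spec of record = res-L1-w44b-tri-1's REFEREE-KC3
934cc3b7642bc99f, links L0, L3–L6, and CHAIN v13.2 §V13.10). OURS; AI-written, weaker than expert review; nothing here is a statement
of the manuscript under study (Hironaka 2017), and no statement of it is used. No theorem here concludes the crux.

THE STEP. In the crux `Persistence` the tower is `T₀ = loc O A`, `T_{m+1} = loc O (nrm (chart O T_m))` (`NoZeno.Birth.tower_succ`). The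
K-C3 chain needs `T₁ = W_{𝔪_W}` EXACTLY for an explicit `W` (the `x`-chart `k[a⁶, a⁴b, a³c, a²b², abc, c², b³]` of the blow-up of
`xy = z³ + t⁴` along `(x, y, z², zt, t²)`). Links L4–L6 of the referee memo are an instance of the following vocabulary-level facts,
proved here once and for all (any fields `k ⊆ K`, any valuation subring `O`, any subalgebras):
* §1 monotonicity / extensivity of `loc`, `nrm`, `chart` are route `SyzygyFlattening`'s `locAt_mono` / `nrm_mono` / `self_le_*`
  (identical bodies, `rfl` bridges `loc_eq_locAt` / `nrm_eq_nrm`) — used here through private transports, not restated;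
* §2 THE CLOSED FORM OF `loc`: the generating fractions `a·s⁻¹` (`a, s ∈ W`, `s⁻¹ ∈ O`) ALREADY form a `k`-subalgebra, so
  `y ∈ loc O W ↔ ∃ a s, …` (`mem_loc_iff`), whence `loc_loc : loc O (loc O W) = loc O W` and
  `loc_eq_of_le_of_le : W ≤ B ≤ loc O W ⇒ loc O B = loc O W` (L6 «loc of anything between W and W_loc is W_loc»);
* §3 THE SANDWICH: `W ≤ chart O T_m ≤ loc O W` and `nrm (loc O W) ≤ loc O W` (`W_loc` integrally closed in `K`) ⇒
  `T_{m+1} = loc O W` (`tower_succ_eq_loc_of_sandwich`, `tower_one_eq_loc_of_sandwich`) — L4 + L5 + L6 assembled.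
Part 2 (the K-C3 instance: `W ≤ chart`, `chart ≤ loc O W` from `ca T₀ = (x, y, z², zt, t²)·T₀` and the monomial valuation, with the
normality of `W_loc` as the one named hypothesis) is a separate landing.

References: none needed (elementary subalgebra bookkeeping); vocabulary [cite: IyengarTakahashi2014, Definition 2.1] for `ca` only.
-/

noncomputable section

set_option linter.dupNamespace false

open Summit.ResolutionOfSingularities.ResolutionOfSingularities.Theorems.NoZeno.Birth

namespace Summit.ResolutionOfSingularities.ResolutionOfSingularities.Theorems.HomologicalConductor.PersistenceKC3Tower

variable {k K : Type} [Field k] [Field K] [Algebra k K]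

/-! ## §1 Monotonicity of `loc` and `nrm` — route `SyzygyFlattening`'s `locAt_mono` / `nrm_mono` transported along the `rfl`
bridges `NoZeno.Birth.loc_eq_locAt`, `NoZeno.Birth.nrm_eq_nrm` (no restatement: used inline below as `locMono` / `nrmMono`). -/


/-- `loc O` is monotone — `SyzygyFlattening.locAt_mono` along `loc_eq_locAt`. [folklore] -/
private theorem locMono (O : ValuationSubring K) {B B' : Subalgebra k K} (h : B ≤ B') : loc O B ≤ loc O B' := by
  rw [loc_eq_locAt, loc_eq_locAt]
  exact SyzygyFlattening.locAt_mono O h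

/-- `nrm` is monotone — `SyzygyFlattening.nrm_mono` along `nrm_eq_nrm`. [folklore] -/
private theorem nrmMono {B B' : Subalgebra k K} (h : B ≤ B') : nrm B ≤ nrm B' := by
  rw [nrm_eq_nrm, nrm_eq_nrm]
  exact SyzygyFlattening.nrm_mono h

/-! ## §2 The closed form of `loc` and its idempotence -/

/-- The set of generating fractions of `loc O W`. -/
private theorem fractions_isSubalgebra (O : ValuationSubring K) (W : Subalgebra k K) :
    ∃ L : Subalgebra k K, (L : Set K) = {y : K | ∃ a ∈ W, ∃ s ∈ W, s⁻¹ ∈ O ∧ y = a * s⁻¹} := by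
  refine ⟨{ carrier := {y : K | ∃ a ∈ W, ∃ s ∈ W, s⁻¹ ∈ O ∧ y = a * s⁻¹}
            mul_mem' := ?_, one_mem' := ?_, add_mem' := ?_, zero_mem' := ?_, algebraMap_mem' := ?_ }, rfl⟩
  · rintro _ _ ⟨a, ha, s, hs, hsO, rfl⟩ ⟨a', ha', s', hs', hs'O, rfl⟩
    refine ⟨a * a', W.mul_mem ha ha', s * s', W.mul_mem hs hs', ?_, ?_⟩
    · rw [mul_inv]; exact O.mul_mem _ _ hsO hs'O
    · rw [mul_inv]; ring
  · exact ⟨1, W.one_mem, 1, W.one_mem, by rw [inv_one]; exact O.one_mem, by rw [inv_one, mul_one]⟩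
  · rintro _ _ ⟨a, ha, s, hs, hsO, rfl⟩ ⟨a', ha', s', hs', hs'O, rfl⟩
    by_cases h0 : s = 0
    · subst h0
      exact ⟨a', ha', s', hs', hs'O, by rw [inv_zero, mul_zero, zero_add]⟩
    by_cases h0' : s' = 0
    · subst h0'
      exact ⟨a, ha, s, hs, hsO, by rw [inv_zero, mul_zero, add_zero]⟩
    refine ⟨a * s' + a' * s, W.add_mem (W.mul_mem ha hs') (W.mul_mem ha' hs), s * s', W.mul_mem hs hs', ?_, ?_⟩
    · rw [mul_inv]; exact O.mul_mem _ _ hsO hs'O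
    · field_simp
  · exact ⟨0, W.zero_mem, 1, W.one_mem, by rw [inv_one]; exact O.one_mem, by rw [zero_mul]⟩
  · intro c
    exact ⟨algebraMap k K c, W.algebraMap_mem c, 1, W.one_mem, by rw [inv_one]; exact O.one_mem,
      by rw [inv_one, mul_one]⟩

/-- **Closed form of `loc`.** `y ∈ loc O W ↔ y = a · s⁻¹` with `a, s ∈ W`, `s⁻¹ ∈ O`: the generating fractions already form a
`k`-subalgebra (common denominators; `(s s′)⁻¹ = s⁻¹ s′⁻¹ ∈ O`). [folklore] -/
theorem mem_loc_iff (O : ValuationSubring K) (W : Subalgebra k K) {y : K} :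
    y ∈ loc O W ↔ ∃ a ∈ W, ∃ s ∈ W, s⁻¹ ∈ O ∧ y = a * s⁻¹ := by
  obtain ⟨L, hL⟩ := fractions_isSubalgebra O W
  have h : loc O W = L := by
    apply le_antisymm
    · change Algebra.adjoin k _ ≤ L
      rw [Algebra.adjoin_le_iff, ← hL]
    · intro z hz
      have hz' : z ∈ (L : Set K) := hz
      rw [hL] at hz'
      exact Algebra.subset_adjoin hz'
  rw [h, ← SetLike.mem_coe, hL]
  rfl

/-- **Idempotence of `loc`.** [folklore] -/
theorem loc_loc (O : ValuationSubring K) (W : Subalgebra k K) : loc O (loc O W) = loc O W := by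
  have hle : loc O W ≤ loc O (loc O W) := fun b hb => by
    refine Algebra.subset_adjoin ⟨b, hb, 1, (loc O W).one_mem, ?_, ?_⟩
    · rw [inv_one]; exact O.one_mem
    · rw [inv_one, mul_one]
  refine le_antisymm ?_ hle
  change Algebra.adjoin k _ ≤ _
  rw [Algebra.adjoin_le_iff]
  rintro _ ⟨a, ha, s, hs, hsO, rfl⟩
  rw [SetLike.mem_coe, mem_loc_iff]
  rw [mem_loc_iff] at ha hs
  obtain ⟨a₁, ha₁, s₁, hs₁, hs₁O, rfl⟩ := ha
  obtain ⟨a₂, ha₂, s₂, hs₂, hs₂O, rfl⟩ := hs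
  by_cases h2 : s₂ = 0
  · subst h2
    exact ⟨0, W.zero_mem, 1, W.one_mem, by rw [inv_one]; exact O.one_mem, by simp⟩
  by_cases ha2 : a₂ = 0
  · subst ha2
    exact ⟨0, W.zero_mem, 1, W.one_mem, by rw [inv_one]; exact O.one_mem, by simp⟩
  -- `a₂⁻¹ = (a₂ s₂⁻¹)⁻¹ · s₂⁻¹ ∈ O`
  have ha₂O : a₂⁻¹ ∈ O := by
    have : a₂⁻¹ = (a₂ * s₂⁻¹)⁻¹ * s₂⁻¹ := by field_simp
    rw [this]
    exact O.mul_mem _ _ hsO hs₂O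
  refine ⟨a₁ * s₂, W.mul_mem ha₁ hs₂, s₁ * a₂, W.mul_mem hs₁ ha₂, ?_, ?_⟩
  · rw [mul_inv]; exact O.mul_mem _ _ hs₁O ha₂O
  · field_simp

/-- L6: `loc` of anything between `W` and `loc O W` is `loc O W`. [folklore] -/
theorem loc_eq_of_le_of_le (O : ValuationSubring K) {W B : Subalgebra k K} (h₁ : W ≤ B) (h₂ : B ≤ loc O W) :
    loc O B = loc O W :=
  le_antisymm (by simpa only [loc_loc] using locMono O h₂) (locMono O h₁)

/-! ## §3 The sandwich theorem for a tower step -/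

/-- **The tower step by sandwich** (L4 + L5 + L6): if `W ≤ chart O T_m ≤ loc O W` and `loc O W` is integrally closed in `K`
(`nrm (loc O W) ≤ loc O W`), then `T_{m+1} = loc O W`. [folklore] -/
theorem tower_succ_eq_loc_of_sandwich (O : ValuationSubring K) (A W : Subalgebra k K) (m : ℕ)
    (hW : W ≤ chart O (tower O A m)) (hchart : chart O (tower O A m) ≤ loc O W)
    (hnrm : nrm (loc O W) ≤ loc O W) : tower O A (m + 1) = loc O W := by
  rw [tower_succ]
  apply le_antisymm
  · calc loc O (nrm (chart O (tower O A m))) ≤ loc O (nrm (loc O W)) := locMono O (nrmMono hchart)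
      _ ≤ loc O (loc O W) := locMono O hnrm
      _ = loc O W := loc_loc O W
  · calc loc O W ≤ loc O (chart O (tower O A m)) := locMono O hW
      _ ≤ loc O (nrm (chart O (tower O A m))) := locMono O fun b hb =>
          Algebra.subset_adjoin (isIntegral_algebraMap (R := ↥(chart O (tower O A m))) (A := K) (x := ⟨b, hb⟩))

/-- **`T₁ = loc O W` by sandwich** (the K-C3 shape: `T₀ = loc O A`). [folklore] -/
theorem tower_one_eq_loc_of_sandwich (O : ValuationSubring K) (A W : Subalgebra k K)
    (hW : W ≤ chart O (loc O A)) (hchart : chart O (loc O A) ≤ loc O W)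
    (hnrm : nrm (loc O W) ≤ loc O W) : tower O A 1 = loc O W :=
  tower_succ_eq_loc_of_sandwich O A W 0 (by rwa [tower_zero]) (by rwa [tower_zero]) hnrm

/-- The two inclusions separately, for consumers that only have one side: `W ≤ chart O T_m ⇒ loc O W ≤ T_{m+1}`. [folklore] -/
theorem loc_le_tower_succ (O : ValuationSubring K) (A W : Subalgebra k K) (m : ℕ) (hW : W ≤ chart O (tower O A m)) :
    loc O W ≤ tower O A (m + 1) := by
  rw [tower_succ]
  exact (locMono O hW).trans (locMono O fun b hb =>
    Algebra.subset_adjoin (isIntegral_algebraMap (R := ↥(chart O (tower O A m))) (A := K) (x := ⟨b, hb⟩)))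

/-- … and `chart O T_m ≤ loc O W`, `loc O W` integrally closed ⇒ `T_{m+1} ≤ loc O W`. [folklore] -/
theorem tower_succ_le_loc (O : ValuationSubring K) (A W : Subalgebra k K) (m : ℕ)
    (hchart : chart O (tower O A m) ≤ loc O W) (hnrm : nrm (loc O W) ≤ loc O W) : tower O A (m + 1) ≤ loc O W := by
  rw [tower_succ]
  calc loc O (nrm (chart O (tower O A m))) ≤ loc O (nrm (loc O W)) := locMono O (nrmMono hchart)
    _ ≤ loc O (loc O W) := locMono O hnrm
    _ = loc O W := loc_loc O W

end Summit.ResolutionOfSingularities.ResolutionOfSingularities.Theorems.HomologicalConductor.PersistenceKC3Tower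

end
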